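import Summits.QuantumFields.QCD.Theses.SpectralDefectExtinction
import Literature.MathematicalPhysics.QuantumFieldTheory.QCDPhaseQuenched
import Literature.MathematicalPhysics.QuantumFieldTheory.SpectralDefectDensity
import Literature.Barriers.QuantumFields.WilsonDeterminantMassSplitting

/-!
# Stub `localTraceRegular` of line `Sketch` (skeleton "ResolventCell") for crux
`SpectralDefectExtinction.WegnerEstimate` (item stmt-QuantumFields-8966)

For the Hermitian Wilson–Dirac operator `H(U) = Γ₅ D_W(U, m₀, 1)` and `ε > 0`, the site-local trace
of the imaginary part of the resolvent,
`t_x(U) = Σ_{a,α} Im ((H(U) − iε)⁻¹)_{(x,a,α),(x,a,α)}`,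
is continuous in the gauge field `U` and takes values in `[0, 12/ε]`.

Proof: for a Hermitian matrix `A = V diag(λ) V⋆` (spectral theorem) one has
`(A − iε)⁻¹ = V diag((λ_j − iε)⁻¹) V⋆`, so the diagonal entry is
`((A − iε)⁻¹)_{ii} = Σ_j |V_{ij}|² (λ_j − iε)⁻¹` with imaginary part
`Σ_j |V_{ij}|² ε/(λ_j² + ε²) ∈ [0, ε⁻¹ Σ_j |V_{ij}|²] = [0, 1/ε]` (rows of the unitary `V` have unit
norm); summing the `12 = 3 · 4` colour–spin entries at the site gives `[0, 12/ε]`.  Continuity: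
`U ↦ H(U) − iε` is continuous (`continuous_wilsonDirac`) with nowhere-vanishing determinant, and the
matrix inverse is continuous at every invertible matrix (`continuousAt_matrix_inv`).
-/

noncomputable section

namespace Summit.QuantumFields.QCD.Cruxes.WegnerEstimate.ResolventCell

open MeasureTheory
open scoped Matrix BigOperators
open Literature.MathematicalPhysics.QuantumLattice Literature.MathematicalPhysics.QuantumFieldTheory
  Literature.Probability.LatticeModels
open Literature.Barriers.QuantumFields (isHermitian_gammaFive_mul_wilsonDirac)
open Matrix

/-- **Resolvent of a Hermitian matrix at `iε`.**  For a Hermitian `A : Matrix n n ℂ` and `ε > 0`,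
`A − iε` has nonzero determinant and `(A − iε)⁻¹ = V diag((λ_j − iε)⁻¹) V⋆`, where
`A = V diag(λ) V⋆` is the spectral decomposition (`V = hA.eigenvectorUnitary`,
`λ = hA.eigenvalues`). -/
theorem localTraceRegular_inv_eq {n : Type*} [Fintype n] [DecidableEq n]
    {A : Matrix n n ℂ} (hA : A.IsHermitian) {ε : ℝ} (hε : 0 < ε) :
    (A - ((ε : ℂ) * Complex.I) • (1 : Matrix n n ℂ)).det ≠ 0 ∧
    (A - ((ε : ℂ) * Complex.I) • (1 : Matrix n n ℂ))⁻¹ =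
      (hA.eigenvectorUnitary : Matrix n n ℂ) *
        diagonal (fun j => ((((hA.eigenvalues j : ℝ) : ℂ) - (ε : ℂ) * Complex.I)⁻¹)) *
        star (hA.eigenvectorUnitary : Matrix n n ℂ) := by
  -- adapted from the sibling `countLeResolvent_of_isHermitian`
  set V : Matrix n n ℂ := (hA.eigenvectorUnitary : Matrix n n ℂ) with hVdef
  have hVmem := (hA.eigenvectorUnitary).2
  have hV1 : star V * V = 1 := Unitary.star_mul_self_of_mem hVmem
  have hV2 : V * star V = 1 := Unitary.mul_star_self_of_mem hVmem
  have hspec : A = V * diagonal (RCLike.ofReal ∘ hA.eigenvalues) * star V := hA.spectral_theorem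
  set d : n → ℂ := fun j => ((hA.eigenvalues j : ℝ) : ℂ) - (ε : ℂ) * Complex.I with hd
  have hd_ne : ∀ j, d j ≠ 0 := by
    intro j h
    have him := congrArg Complex.im h
    simp only [hd, Complex.sub_im, Complex.ofReal_im, Complex.mul_im, Complex.ofReal_re,
      Complex.I_im, Complex.I_re, mul_one, mul_zero, add_zero, zero_sub, Complex.zero_im,
      neg_eq_zero] at him
    exact hε.ne' him
  have hdiag : diagonal (RCLike.ofReal ∘ hA.eigenvalues) - ((ε : ℂ) * Complex.I) • (1 : Matrix n n ℂ) =
      diagonal d := by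
    rw [smul_one_eq_diagonal, diagonal_sub, hd]
    rfl
  have hshift : A - ((ε : ℂ) * Complex.I) • (1 : Matrix n n ℂ) = V * diagonal d * star V := by
    rw [← hdiag, Matrix.mul_sub, Matrix.sub_mul, Matrix.mul_smul, Matrix.mul_one, Matrix.smul_mul,
      hV2, ← hspec]
  have hright : (A - ((ε : ℂ) * Complex.I) • (1 : Matrix n n ℂ)) *
      (V * diagonal (fun j => (d j)⁻¹) * star V) = 1 := by
    rw [hshift]
    have hdd : diagonal d * diagonal (fun j => (d j)⁻¹) = (1 : Matrix n n ℂ) := by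
      rw [diagonal_mul_diagonal, ← diagonal_one]
      congr 1
      funext j
      exact mul_inv_cancel₀ (hd_ne j)
    calc V * diagonal d * star V * (V * diagonal (fun j => (d j)⁻¹) * star V)
        = V * (diagonal d * (star V * V) * diagonal (fun j => (d j)⁻¹)) * star V := by
          simp only [Matrix.mul_assoc]
      _ = 1 := by rw [hV1, Matrix.mul_one, hdd, Matrix.mul_one, hV2]
  exact ⟨(Matrix.isUnit_det_of_right_inverse hright).ne_zero, Matrix.inv_eq_right_inv hright⟩

/-- Diagonal entries of a conjugated diagonal matrix: `(V diag(f) V⋆)_{ii} = Σ_j f_j |V_{ij}|²`. -/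
theorem localTraceRegular_conj_diag_apply {n : Type*} [Fintype n] [DecidableEq n]
    (V : Matrix n n ℂ) (f : n → ℂ) (i : n) :
    (V * diagonal f * star V) i i = ∑ j, f j * (Complex.normSq (V i j) : ℂ) := by
  rw [Matrix.mul_apply]
  refine Finset.sum_congr rfl fun j _ => ?_
  rw [Matrix.mul_diagonal, Matrix.star_apply, ← Complex.mul_conj]
  change V i j * f j * (starRingEnd ℂ) (V i j) = _
  ring

/-- Rows of a unitary matrix have unit norm: `Σ_j |V_{ij}|² = 1` when `V V⋆ = 1`. -/
theorem localTraceRegular_row_normSq {n : Type*} [Fintype n] [DecidableEq n]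
    {V : Matrix n n ℂ} (hV : V * star V = 1) (i : n) :
    ∑ j, Complex.normSq (V i j) = 1 := by
  have h := localTraceRegular_conj_diag_apply V (fun _ => (1 : ℂ)) i
  rw [diagonal_one, Matrix.mul_one, hV, Matrix.one_apply_eq] at h
  simp only [one_mul] at h
  exact_mod_cast h.symm

/-- The scalar Wegner window bound `0 ≤ ε/(a² + ε²) ≤ 1/ε` for `ε > 0`. -/
theorem localTraceRegular_window_mem (a ε : ℝ) (hε : 0 < ε) :
    0 ≤ ε / (a ^ 2 + ε ^ 2) ∧ ε / (a ^ 2 + ε ^ 2) ≤ 1 / ε := by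
  have hpos : 0 < a ^ 2 + ε ^ 2 := by positivity
  refine ⟨by positivity, ?_⟩
  rw [div_le_div_iff₀ hpos hε]
  nlinarith [sq_nonneg a]

/-- **Diagonal of the imaginary part of the resolvent.**  For a Hermitian `A : Matrix n n ℂ`,
`ε > 0` and every index `i`, `0 ≤ Im ((A − iε)⁻¹)_{ii} ≤ 1/ε`
(`Im ((A − iε)⁻¹)_{ii} = Σ_j |V_{ij}|² ε/(λ_j² + ε²)` and `Σ_j |V_{ij}|² = 1`). -/
theorem localTraceRegular_diag_im_mem {n : Type*} [Fintype n] [DecidableEq n]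
    {A : Matrix n n ℂ} (hA : A.IsHermitian) {ε : ℝ} (hε : 0 < ε) (i : n) :
    0 ≤ ((A - ((ε : ℂ) * Complex.I) • (1 : Matrix n n ℂ))⁻¹ i i).im ∧
    ((A - ((ε : ℂ) * Complex.I) • (1 : Matrix n n ℂ))⁻¹ i i).im ≤ 1 / ε := by
  -- `Im (a − iε)⁻¹ = ε / (a² + ε²)` (the sibling's `countLeResolvent_inv_im`, inlined)
  have hinv_im : ∀ a : ℝ, (((a : ℂ) - (ε : ℂ) * Complex.I)⁻¹).im = ε / (a ^ 2 + ε ^ 2) := by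
    intro a
    rw [Complex.inv_im, Complex.normSq_apply]
    simp only [Complex.sub_re, Complex.sub_im, Complex.ofReal_re, Complex.ofReal_im, Complex.mul_re,
      Complex.mul_im, Complex.I_re, Complex.I_im, mul_zero, mul_one, sub_zero, zero_sub, neg_neg]
    ring
  obtain ⟨-, hinv⟩ := localTraceRegular_inv_eq hA hε
  set V : Matrix n n ℂ := (hA.eigenvectorUnitary : Matrix n n ℂ) with hVdef
  have hV2 : V * star V = 1 := Unitary.mul_star_self_of_mem (hA.eigenvectorUnitary).2
  have hrow : ∑ j, Complex.normSq (V i j) = 1 := localTraceRegular_row_normSq hV2 i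
  have him : ((A - ((ε : ℂ) * Complex.I) • (1 : Matrix n n ℂ))⁻¹ i i).im =
      ∑ j, ε / (hA.eigenvalues j ^ 2 + ε ^ 2) * Complex.normSq (V i j) := by
    rw [hinv, localTraceRegular_conj_diag_apply, Complex.im_sum]
    refine Finset.sum_congr rfl fun j _ => ?_
    rw [Complex.im_mul_ofReal, hinv_im]
  rw [him]
  constructor
  · exact Finset.sum_nonneg fun j _ =>
      mul_nonneg (localTraceRegular_window_mem (hA.eigenvalues j) ε hε).1 (Complex.normSq_nonneg _)
  · calc ∑ j, ε / (hA.eigenvalues j ^ 2 + ε ^ 2) * Complex.normSq (V i j)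
        ≤ ∑ j, 1 / ε * Complex.normSq (V i j) :=
          Finset.sum_le_sum fun j _ => mul_le_mul_of_nonneg_right
            (localTraceRegular_window_mem (hA.eigenvalues j) ε hε).2 (Complex.normSq_nonneg _)
      _ = 1 / ε := by rw [← Finset.mul_sum, hrow, mul_one]

/-- **Stub `localTraceRegular` (deterministic).**  The site-local trace of the imaginary part of the
resolvent, `t_x(U) = Σ_{a,α} Im ((H − iε)⁻¹)_{(x,a,α),(x,a,α)}`, is continuous in the gauge field and takes
values in `[0, 12/ε]` (`(H−iε)⁻¹ − (H+iε)⁻¹ = 2iε (H²+ε²)⁻¹`, `0 ≤ (H²+ε²)⁻¹ ≤ ε⁻²`; continuity: `H(U)` is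
polynomial in the links and `H − iε` is invertible for Hermitian `H`). -/
theorem stub_localTraceRegular (L : ℕ) [NeZero L] (x : TorusSite 4 L) (m₀ ε : ℝ) (hε : 0 < ε) :
    (Continuous fun U : GaugeConfig 4 L SU3 =>
      ∑ a : Fin 3, ∑ α : Fin 4,
        (((spinorLift gammaFive * wilsonDirac (fundamentalRep (Fin 3)) U m₀ 1 -
          ((ε : ℂ) * Complex.I) • (1 : Matrix (QuarkIdx L) (QuarkIdx L) ℂ))⁻¹ :
            Matrix (QuarkIdx L) (QuarkIdx L) ℂ) (x, a, α) (x, a, α)).im) ∧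
    ∀ U : GaugeConfig 4 L SU3,
      0 ≤ ∑ a : Fin 3, ∑ α : Fin 4,
        (((spinorLift gammaFive * wilsonDirac (fundamentalRep (Fin 3)) U m₀ 1 -
          ((ε : ℂ) * Complex.I) • (1 : Matrix (QuarkIdx L) (QuarkIdx L) ℂ))⁻¹ :
            Matrix (QuarkIdx L) (QuarkIdx L) ℂ) (x, a, α) (x, a, α)).im ∧
      ∑ a : Fin 3, ∑ α : Fin 4,
        (((spinorLift gammaFive * wilsonDirac (fundamentalRep (Fin 3)) U m₀ 1 -
          ((ε : ℂ) * Complex.I) • (1 : Matrix (QuarkIdx L) (QuarkIdx L) ℂ))⁻¹ :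
            Matrix (QuarkIdx L) (QuarkIdx L) ℂ) (x, a, α) (x, a, α)).im ≤
        12 / ε := by
  have hHerm : ∀ U : GaugeConfig 4 L SU3,
      (spinorLift gammaFive * wilsonDirac (fundamentalRep (Fin 3)) U m₀ 1).IsHermitian := fun U =>
    isHermitian_gammaFive_mul_wilsonDirac (fundamentalRep (Fin 3)) fundamentalRep_mem_unitaryGroup U m₀ 1
  refine ⟨?_, fun U => ?_⟩
  · -- continuity of the resolvent in the gauge field
    have hB : Continuous fun U : GaugeConfig 4 L SU3 =>
        spinorLift gammaFive * wilsonDirac (fundamentalRep (Fin 3)) U m₀ 1 -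
          ((ε : ℂ) * Complex.I) • (1 : Matrix (QuarkIdx L) (QuarkIdx L) ℂ) :=
      (continuous_const.mul (continuous_wilsonDirac (fundamentalRep (Fin 3))
        (continuous_fundamentalRep (Fin 3)) m₀ 1)).sub continuous_const
    have hR : Continuous fun U : GaugeConfig 4 L SU3 =>
        (spinorLift gammaFive * wilsonDirac (fundamentalRep (Fin 3)) U m₀ 1 -
          ((ε : ℂ) * Complex.I) • (1 : Matrix (QuarkIdx L) (QuarkIdx L) ℂ))⁻¹ :=
      continuous_iff_continuousAt.2 fun U =>
        (continuousAt_matrix_inv _ (by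
          rw [Ring.inverse_eq_inv']
          exact continuousAt_inv₀ (localTraceRegular_inv_eq (hHerm U) hε).1)).comp hB.continuousAt
    exact continuous_finsetSum _ fun a _ => continuous_finsetSum _ fun α _ =>
      Complex.continuous_im.comp (hR.matrix_elem _ _)
  · have h := fun (a : Fin 3) (α : Fin 4) => localTraceRegular_diag_im_mem (hHerm U) hε (x, a, α)
    constructor
    · exact Finset.sum_nonneg fun a _ => Finset.sum_nonneg fun α _ => (h a α).1
    · calc ∑ a : Fin 3, ∑ α : Fin 4,
            (((spinorLift gammaFive * wilsonDirac (fundamentalRep (Fin 3)) U m₀ 1 -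
              ((ε : ℂ) * Complex.I) • (1 : Matrix (QuarkIdx L) (QuarkIdx L) ℂ))⁻¹ :
                Matrix (QuarkIdx L) (QuarkIdx L) ℂ) (x, a, α) (x, a, α)).im
          ≤ ∑ _a : Fin 3, ∑ _α : Fin 4, 1 / ε :=
            Finset.sum_le_sum fun a _ => Finset.sum_le_sum fun α _ => (h a α).2
        _ = 12 / ε := by
            simp only [Finset.sum_const, Finset.card_univ, Fintype.card_fin]
            ring

end Summit.QuantumFields.QCD.Cruxes.WegnerEstimate.ResolventCell

end
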